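import Summits.MatrixMultiplication.MatrixMultiplication.Theorems.SaturationLadderThinRoof
import Summits.MatrixMultiplication.MatrixMultiplication.Theorems.SaturationLadderGaugeConeClasses
import HarnessLib

/-!
# Route `SaturationLadder` on Strassen's spectrum, II: the CORNER GERM of the crux (`ℂ`)

decomp-mm lens 1 «grading / quantitative ladder», gen 43, kernel K43-B (chain file 2/2; file 1 =
`SaturationLadderThinRoof`).  Support module beneath the deciding crux `SubexpSaturation` (stmt-MatrixMultiplication-25909)
of `route-MatrixMultiplication-SaturationLadder`, cut of record UNCHANGED:
`closes (h₁ : SubexpSaturation) (h₂ : SubexpToPoly) (h₃ : PolyToFinite) (h₄ : TailDescentTwo) (h₅ : SquareFromTwo)`.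
Def-free, sorry-free; imports the route file only to name its items (`Theses.SaturationLadder` via
`SaturationLadderGaugeConeClasses`).  `θ = specMMPoint ℂ φ ∈ [0,1]³`, `εᵢ = 1 − θᵢ`, `d = θ₀+θ₁+θ₂−2`.

* §1 **The corner.**  The thin information bound `ω(1,t,r) ≥ 1+r` is carried by the gauge point `ζ⁽¹⁾`
  (`ζ⁽¹⁾⟨k,m,n⟩ = kn`), whose exponent triple is the CORNER `θ(ζ⁽¹⁾) = (1,0,1)` of the cube (`corner_gaugePoint₁`,
  every field) — a light point of height `θ₁ = 0`.
* §2 **The route's items as roof laws** (chain file 1's thin roof `ω(1,t,r) ≤ 1+r ⟺ ∀φ: t·θ₁ ≤ ε₀ + r·ε₂`):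
  `SubexpSaturation ⟺ ∀ c > 0 ∃ t₀ < 1 ∀ t ∈ [t₀,1) ∀φ: t·θ₁ ≤ ε₀ + e^{c/(1−t)}·ε₂` (`subexpSaturation_iff_roof`;
  the `∃ r ≤ e^{c/(1−t)}` of the item is absorbed by monotonicity of roofs); `PolySaturation ⟺ ∃ C k ∀ t ∈ [0,1) ∀φ:
  t·θ₁ ≤ ε₀ + C(1−t)^{−k}·ε₂` (`polySaturation_iff_roof`); the far/onset items are FACE laws at the light face `{θ₂ = 1}`:
  `FiniteSaturation ⟺ ∃ k ≥ 2 ∀φ: θ₁ ≤ ε₀ + k·ε₂`, `ω(1,2,1) = 3 ⟺ ∀φ: θ₁ ≤ ε₀ + 2ε₂`, the summit `⟺ ∀φ: θ₁ ≤ ε₀ + ε₂`,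
  and `TailDescentTwo`, `SquareFromTwo` are the implications between these (`*_iff_face(s)`, `summit_iff_unitRoof`).
* §3 ★ **THE CORNER GERM THEOREM.**  By chain file 1's UNCONDITIONAL high-point law (lens 2's far-edge tower read in
  the third slot) every spectral point of height `θ₁ ≥ η` obeys every subexponential roof; points off the `η`-box
  `B_η = {θ₁ < η, θ₀ > 1−η, θ₂ > 1−η}` at the corner obey it trivially.  Hence
  **`SubexpSaturation ⟺ ∀ c > 0 ∃ η > 0 ∃ t₀ < 1 ∀ t ∈ [t₀,1): the roof `t·θ₁ ≤ ε₀ + e^{c/(1−t)}ε₂` holds at every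
  universal spectral point whose exponent triple lies in the box `B_η` at the corner `(1,0,1)`**
  (`subexpSaturation_iff_cornerGerm`), and likewise `PolySaturation ⟺` a polynomial roof on some corner box
  (`polySaturation_iff_cornerGerm`).  The LENGTH ladder of the route (`ExpSaturation ⊂ SubexpSaturation ⊂ PolySaturation`,
  items 25913/25909/25915) consists of GERM CONDITIONS AT THE GAUGE CORNER `ζ⁽¹⁾`; the ONSET ladder
  (`FiniteSaturation`, `ω(1,2,1) = 3`, `TailDescentTwo`, `SquareFromTwo`) of FACE conditions along `{θ₂ = 1}`; the summit
  is «no dark point anywhere»; `PolyToFinite` (h₃) is the passage corner ⟹ face.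
* §4 **DARK-FREE CORNER ⟹ the length side.**  If some corner box `B_η` contains no dark spectral point, then
  `PolySaturation`, `SubexpSaturation` and `SubexpToPoly` hold (`polySaturation_of_darkFreeCorner`, …): a LOCAL form
  at `ζ⁽¹⁾` of «the spectrum is light» (= `ω = 2`, lens 2's `omega_eq_two_iff_noDark`) already yields `h₁ ∧ h₂`.
* §5 **What is proved at the corner.**  The lineage's certified rates (`clause(c)` for every `c > c₂ =
  (5 log(5/4) + 3 log 2)/3 = 1.0650…`, `SaturationLadderGaugeConeClasses.clause_above_classCeiling`) read: for every
  `c > c₂`, eventually in `t`, EVERY spectral point obeys `t·θ₁ ≤ ε₀ + e^{c/(1−t)}ε₂` (`cornerRoof_above_classCeiling`);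
  the crux is the same pinch of the corner germ at every rate `c ∈ (0, c₂]`.

Nothing here proves `ω = 2` or the crux; no definitions (gate rule D-0009).  [cite: Strassen1988, Thm. 3.8]
[cite: AlmanLi2026, Proposition 4.1; Proposition 4.2] [cite: ChristandlVranaZuiddam2023, Example 1.4; Prop. 1.6]
[cite: LottiRomani1983, Thm. 2; Prop. 4.1] [cite: CoppersmithWinograd1990, §8] [cite: AlmanDuanVassilevskaWilliamsXuXuZhou2025, §3.4]
-/

set_option linter.dupNamespace false

noncomputable section

open scoped BigOperators

namespace Summit.MatrixMultiplication.MatrixMultiplication.Theorems.SaturationLadderCornerGerm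

open Literature.Computability.AlgebraicComplexity
open Summit.MatrixMultiplication.MatrixMultiplication.Theses.SaturationLadder
open Summit.MatrixMultiplication.MatrixMultiplication.Theorems.SaturationLadderThinRoof
open Summit.MatrixMultiplication.MatrixMultiplication.Theorems.SaturationLadderGaugeConeClasses
  (clause_above_classCeiling classCeiling_pos)

variable {K : Type} [Field K]

/-! ## §1 The corner of record is the gauge point `ζ⁽¹⁾` -/

/-- **The corner `(1,0,1)` is the exponent triple of the gauge point `ζ⁽¹⁾`** (`ζ⁽¹⁾⟨k,m,n⟩ = kn`, the flattening
that carries the thin information bound `ω(1,t,r) ≥ 1 + r`): `ζ⁽¹⁾` is a universal spectral point with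
`θ(ζ⁽¹⁾) = (1, 0, 1)` — a LIGHT point of height `0`, over every field. [cite: ChristandlVranaZuiddam2023, Example 1.4]
[cite: AlmanLi2026, Proposition 4.2 (proof)] -/
theorem corner_gaugePoint₁ :
    IsUniversalSpectralPoint K (gaugePoint₁ K) ∧ specMMPoint K (gaugePoint₁ K) 0 = 1 ∧
      specMMPoint K (gaugePoint₁ K) 1 = 0 ∧ specMMPoint K (gaugePoint₁ K) 2 = 1 := by
  refine ⟨gaugePoint₁_isUniversalSpectralPoint K, ?_, ?_, ?_⟩
  · rw [specMMPoint_zero, gaugePoint₁_matMulTensor (by norm_num)]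
    norm_num [Real.logb_self_eq_one]
  · rw [specMMPoint_one, gaugePoint₁_matMulTensor (by norm_num)]
    norm_num
  · rw [specMMPoint_two, gaugePoint₁_matMulTensor (by norm_num)]
    norm_num [Real.logb_self_eq_one]

/-- **Off the corner box, low points obey every long roof for free**: if `θ₁ < η` and (`θ₀ ≤ 1−η` or `θ₂ ≤ 1−η`),
then `t·θ₁ ≤ ε₀ + R·ε₂` for all `t ≤ 1 ≤ R` (`t·θ₁ ≤ θ₁ < η ≤ ε₀`, resp. `≤ ε₂ ≤ R·ε₂`).
[cite: AlmanLi2026, Proposition 4.2] -/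
theorem roof_of_offBox {F : SpectralMap K} (hF : IsUniversalSpectralPoint K F) {η t R : ℝ}
    (ht1 : t ≤ 1) (hR : 1 ≤ R) (hlow : specMMPoint K F 1 < η)
    (hoff : specMMPoint K F 0 ≤ 1 - η ∨ specMMPoint K F 2 ≤ 1 - η) :
    t * specMMPoint K F 1 ≤ (1 - specMMPoint K F 0) + R * (1 - specMMPoint K F 2) := by
  have hθ1 := (AlmanLi2026.prop42_mem_Icc hF 1).1
  have hε0 : 0 ≤ 1 - specMMPoint K F 0 := sub_nonneg.2 (AlmanLi2026.prop42_mem_Icc hF 0).2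
  have hε2 : 0 ≤ 1 - specMMPoint K F 2 := sub_nonneg.2 (AlmanLi2026.prop42_mem_Icc hF 2).2
  have htθ : t * specMMPoint K F 1 ≤ specMMPoint K F 1 := by nlinarith
  have hRε : (1 - specMMPoint K F 2) ≤ R * (1 - specMMPoint K F 2) := by nlinarith
  rcases hoff with h0 | h2
  · linarith
  · linarith

/-! ## §2 The route's items as roof and face laws (`ℂ`) -/

/-- **The thin clause at one rate `c ≥ 0` is a roof clause**: `(∃ t₀ < 1 ∀ t ∈ [t₀,1) ∃ r ∈ [1, e^{c/(1−t)}],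
ω(1,t,r) ≤ 1+r) ⟺ (∃ t₀ < 1 ∀ t ∈ [t₀,1) ∀φ: t·θ₁ ≤ ε₀ + e^{c/(1−t)}·ε₂)` — the length `r` is absorbed into
the longest admissible one by monotonicity of roofs (`roof_mono`), and `t₀ ≥ 0` may be assumed.
[cite: Strassen1988, Thm. 3.8] [cite: LottiRomani1983, Thm. 2] -/
theorem clause_iff_roofClause {c : ℝ} (hc : 0 ≤ c) :
    (∃ t₀ : ℝ, t₀ < 1 ∧ ∀ t : ℝ, t₀ ≤ t → t < 1 →
        ∃ r : ℝ, 1 ≤ r ∧ r ≤ Real.exp (c / (1 - t)) ∧ omegaRect ℂ 1 t r ≤ 1 + r) ↔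
      ∃ t₀ : ℝ, t₀ < 1 ∧ ∀ t : ℝ, t₀ ≤ t → t < 1 → ∀ F : SpectralMap ℂ, IsUniversalSpectralPoint ℂ F →
        t * specMMPoint ℂ F 1 ≤ (1 - specMMPoint ℂ F 0) + Real.exp (c / (1 - t)) * (1 - specMMPoint ℂ F 2) := by
  constructor
  · rintro ⟨t₀, ht₀, h⟩
    refine ⟨max t₀ 0, max_lt ht₀ one_pos, fun t ht ht1 F hF => ?_⟩
    have ht0 : 0 ≤ t := le_trans (le_max_right _ _) ht
    obtain ⟨r, hr1, hrR, hω⟩ := h t (le_trans (le_max_left _ _) ht) ht1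
    exact roof_mono hF le_rfl hrR ((thinTight_iff_roof (K := ℂ) ht0 (by linarith)).1 hω F hF)
  · rintro ⟨t₀, ht₀, h⟩
    refine ⟨max t₀ 0, max_lt ht₀ one_pos, fun t ht ht1 => ?_⟩
    have ht0 : 0 ≤ t := le_trans (le_max_right _ _) ht
    have hR : 1 ≤ Real.exp (c / (1 - t)) := Real.one_le_exp (div_nonneg hc (by linarith))
    exact ⟨Real.exp (c / (1 - t)), hR, le_rfl,
      (thinTight_iff_roof (K := ℂ) ht0 (by linarith)).2 (h t (le_trans (le_max_left _ _) ht) ht1)⟩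

/-- ★ **`SubexpSaturation` on the spectrum**: the crux holds iff for every rate `c > 0`, eventually in `t → 1⁻`,
every universal spectral point over `ℂ` obeys the roof `t·θ₁ ≤ (1−θ₀) + e^{c/(1−t)}·(1−θ₂)`.
[cite: Strassen1988, Thm. 3.8] [cite: AlmanDuanVassilevskaWilliamsXuXuZhou2025, §3.4] -/
theorem subexpSaturation_iff_roof :
    SubexpSaturation ↔ ∀ c : ℝ, 0 < c → ∃ t₀ : ℝ, t₀ < 1 ∧ ∀ t : ℝ, t₀ ≤ t → t < 1 →
      ∀ F : SpectralMap ℂ, IsUniversalSpectralPoint ℂ F →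
        t * specMMPoint ℂ F 1 ≤ (1 - specMMPoint ℂ F 0) + Real.exp (c / (1 - t)) * (1 - specMMPoint ℂ F 2) := by
  unfold SubexpSaturation
  exact forall₂_congr fun c hc => clause_iff_roofClause hc.le

/-- ★ **`PolySaturation` on the spectrum**: `PolySaturation ⟺ ∃ C k ∀ t ∈ [0,1) ∀φ:
t·θ₁ ≤ (1−θ₀) + C·(1−t)^{−k}·(1−θ₂)` (backwards the constant is raised to `max C 1` so that the length
`C(1−t)^{−k} ≥ 1` is admissible). [cite: Strassen1988, Thm. 3.8] [cite: LottiRomani1983, Thm. 2] -/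
theorem polySaturation_iff_roof :
    PolySaturation ↔ ∃ (C : ℝ) (k : ℕ), ∀ t : ℝ, 0 ≤ t → t < 1 →
      ∀ F : SpectralMap ℂ, IsUniversalSpectralPoint ℂ F →
        t * specMMPoint ℂ F 1 ≤ (1 - specMMPoint ℂ F 0) + C * ((1 - t)⁻¹) ^ k * (1 - specMMPoint ℂ F 2) := by
  unfold PolySaturation
  constructor
  · rintro ⟨C, k, h⟩
    refine ⟨C, k, fun t ht0 ht1 F hF => ?_⟩
    obtain ⟨r, hr1, hrC, hω⟩ := h t ht0 ht1
    exact roof_mono hF le_rfl hrC ((thinTight_iff_roof (K := ℂ) ht0 (by linarith)).1 hω F hF)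
  · rintro ⟨C, k, h⟩
    refine ⟨max C 1, k, fun t ht0 ht1 => ?_⟩
    have hu : 1 ≤ (1 - t)⁻¹ := (one_le_inv₀ (by linarith)).2 (by linarith)
    have huk : (1 : ℝ) ≤ ((1 - t)⁻¹) ^ k := one_le_pow₀ hu
    have hr1 : (1 : ℝ) ≤ max C 1 * ((1 - t)⁻¹) ^ k := by
      calc (1 : ℝ) = 1 * 1 := by ring
        _ ≤ max C 1 * ((1 - t)⁻¹) ^ k :=
          mul_le_mul (le_max_right _ _) huk zero_le_one (le_trans zero_le_one (le_max_right _ _))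
    have hCk : C * ((1 - t)⁻¹) ^ k ≤ max C 1 * ((1 - t)⁻¹) ^ k :=
      mul_le_mul_of_nonneg_right (le_max_left _ _) (le_trans zero_le_one huk)
    exact ⟨max C 1 * ((1 - t)⁻¹) ^ k, hr1, le_rfl, (thinTight_iff_roof (K := ℂ) ht0 (le_trans zero_le_one hr1)).2
      fun F hF => roof_mono hF le_rfl hCk (h t ht0 ht1 F hF)⟩

/-- **Far tight points are face laws** (natural `k`): `ω(1,k,1) = k+1 ⟺ ∀φ: θ₁ ≤ ε₀ + k·ε₂`.
[cite: Strassen1988, Thm. 3.8] [cite: LottiRomani1983, Thm. 1] -/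
theorem farExact_iff_face (k : ℕ) :
    omegaRect ℂ 1 k 1 = k + 1 ↔ ∀ F : SpectralMap ℂ, IsUniversalSpectralPoint ℂ F →
      specMMPoint ℂ F 1 ≤ (1 - specMMPoint ℂ F 0) + k * (1 - specMMPoint ℂ F 2) := by
  rw [← farTight_iff_roof (K := ℂ) (Nat.cast_nonneg k)]
  have := add_le_omegaRect₁₂ ℂ 1 (k : ℝ) 1
  exact ⟨fun h => h.le, fun h => le_antisymm h (by linarith)⟩

/-- **`FiniteSaturation` is a face law**: `∃ k ≥ 2 ∀φ: θ₁ ≤ ε₀ + k·ε₂` (lens 2's `finiteSaturationShape_iff_cone`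
is the middle-slot reading). [cite: Strassen1988, Thm. 3.8] [cite: LottiRomani1983, Thm. 1] -/
theorem finiteSaturation_iff_face :
    FiniteSaturation ↔ ∃ k : ℕ, 2 ≤ k ∧ ∀ F : SpectralMap ℂ, IsUniversalSpectralPoint ℂ F →
      specMMPoint ℂ F 1 ≤ (1 - specMMPoint ℂ F 0) + k * (1 - specMMPoint ℂ F 2) := by
  unfold FiniteSaturation
  exact exists_congr fun k => and_congr Iff.rfl (farExact_iff_face k)

/-- **The double square `ω(1,2,1) = 3` is the face law of slope two**: `∀φ: θ₁ ≤ ε₀ + 2ε₂`.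
[cite: Strassen1988, Thm. 3.8] [cite: LottiRomani1983, Thm. 1] -/
theorem doubleSquare_iff_face :
    omegaRect ℂ 1 2 1 = 3 ↔ ∀ F : SpectralMap ℂ, IsUniversalSpectralPoint ℂ F →
      specMMPoint ℂ F 1 ≤ (1 - specMMPoint ℂ F 0) + 2 * (1 - specMMPoint ℂ F 2) := by
  have h := farExact_iff_face 2
  push_cast at h
  rw [show (2 : ℝ) + 1 = 3 by norm_num] at h
  exact h

/-- **The summit is the unit roof**: `ω(ℂ) = 2 ⟺ ∀φ: θ₁ ≤ ε₀ + ε₂` (no dark point; lens 2's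
`omega_eq_two_iff_noDark`, rearranged). [cite: Strassen1988, Thm. 3.8] [cite: AlmanLi2026, Proposition 4.2] -/
theorem summit_iff_unitRoof :
    _root_.MatrixMultiplication ↔ ∀ F : SpectralMap ℂ, IsUniversalSpectralPoint ℂ F →
      specMMPoint ℂ F 1 ≤ (1 - specMMPoint ℂ F 0) + (1 - specMMPoint ℂ F 2) := by
  rw [_root_.MatrixMultiplication_iff, ← omegaRect_one_one_one ℂ, plateau_iff_roof (K := ℂ) zero_le_one]
  simp only [one_mul]

/-- **`TailDescentTwo` between face laws**: `(∃ k ≥ 3: face law of slope k) → face law of slope 2`.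
[cite: Strassen1988, Thm. 3.8] -/
theorem tailDescentTwo_iff_faces :
    TailDescentTwo ↔
      ((∃ k : ℕ, 3 ≤ k ∧ ∀ F : SpectralMap ℂ, IsUniversalSpectralPoint ℂ F →
          specMMPoint ℂ F 1 ≤ (1 - specMMPoint ℂ F 0) + k * (1 - specMMPoint ℂ F 2)) →
        ∀ F : SpectralMap ℂ, IsUniversalSpectralPoint ℂ F →
          specMMPoint ℂ F 1 ≤ (1 - specMMPoint ℂ F 0) + 2 * (1 - specMMPoint ℂ F 2)) := by
  unfold TailDescentTwo
  exact imp_congr (exists_congr fun k => and_congr Iff.rfl (farExact_iff_face k)) doubleSquare_iff_face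

/-- **`SquareFromTwo` between face laws**: face law of slope 2 → unit roof. [cite: Strassen1988, Thm. 3.8] -/
theorem squareFromTwo_iff_faces :
    SquareFromTwo ↔
      ((∀ F : SpectralMap ℂ, IsUniversalSpectralPoint ℂ F →
          specMMPoint ℂ F 1 ≤ (1 - specMMPoint ℂ F 0) + 2 * (1 - specMMPoint ℂ F 2)) →
        ∀ F : SpectralMap ℂ, IsUniversalSpectralPoint ℂ F →
          specMMPoint ℂ F 1 ≤ (1 - specMMPoint ℂ F 0) + (1 - specMMPoint ℂ F 2)) := by
  unfold SquareFromTwo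
  exact imp_congr doubleSquare_iff_face summit_iff_unitRoof

/-! ## §3 The corner germ theorems -/

/-- ★★★ **THE CORNER GERM THEOREM**: `SubexpSaturation` holds if and only if, for every rate `c > 0`, there are a
box size `η > 0` and a threshold `t₀ < 1` such that for all `t ∈ [t₀, 1)` the roof `t·θ₁ ≤ (1−θ₀) + e^{c/(1−t)}·(1−θ₂)`
holds at every universal spectral point over `ℂ` whose exponent triple lies in the corner box
`{θ₁ < η, θ₀ > 1−η, θ₂ > 1−η}` at `θ(ζ⁽¹⁾) = (1,0,1)`.  (High points: chain file 1's unconditional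
`highRoof_subexp_t`; low points off the box: `roof_of_offBox`.)  The crux is a statement about the germ of the
spectrum at ONE gauge point. [cite: Strassen1988, Thm. 3.8] [cite: LottiRomani1983, Prop. 4.1]
[cite: AlmanDuanVassilevskaWilliamsXuXuZhou2025, §3.4] -/
theorem subexpSaturation_iff_cornerGerm :
    SubexpSaturation ↔ ∀ c : ℝ, 0 < c → ∃ η : ℝ, 0 < η ∧ ∃ t₀ : ℝ, t₀ < 1 ∧ ∀ t : ℝ, t₀ ≤ t → t < 1 →
      ∀ F : SpectralMap ℂ, IsUniversalSpectralPoint ℂ F →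
        specMMPoint ℂ F 1 < η → 1 - η < specMMPoint ℂ F 0 → 1 - η < specMMPoint ℂ F 2 →
          t * specMMPoint ℂ F 1 ≤ (1 - specMMPoint ℂ F 0) + Real.exp (c / (1 - t)) * (1 - specMMPoint ℂ F 2) := by
  rw [subexpSaturation_iff_roof]
  constructor
  · intro h c hc
    obtain ⟨t₀, ht₀, ht⟩ := h c hc
    exact ⟨1, one_pos, t₀, ht₀, fun t h1 h2 F hF _ _ _ => ht t h1 h2 F hF⟩
  · intro h c hc
    obtain ⟨η, hη, t₀, ht₀, hbox⟩ := h c hc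
    have hη'0 : 0 < min η 1 := lt_min hη one_pos
    have hη'1 : min η 1 ≤ 1 := min_le_right _ _
    have hη'η : min η 1 ≤ η := min_le_left _ _
    have ht₁1 : 1 - min 1 (c ^ 5 * (min η 1) ^ 4 / 92160) < 1 := by
      have : 0 < min 1 (c ^ 5 * (min η 1) ^ 4 / 92160) := lt_min one_pos (by positivity)
      linarith
    refine ⟨max t₀ (1 - min 1 (c ^ 5 * (min η 1) ^ 4 / 92160)), max_lt ht₀ ht₁1,
      fun t ht ht1 F hF => ?_⟩
    have htt₀ : t₀ ≤ t := le_trans (le_max_left _ _) ht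
    have htt₁ : 1 - min 1 (c ^ 5 * (min η 1) ^ 4 / 92160) ≤ t := le_trans (le_max_right _ _) ht
    by_cases hhigh : min η 1 ≤ specMMPoint ℂ F 1
    · exact highRoof_subexp_t hη'0 hη'1 hc htt₁ ht1 hF hhigh
    · push Not at hhigh
      have hR : 1 ≤ Real.exp (c / (1 - t)) := Real.one_le_exp (div_nonneg hc.le (by linarith))
      by_cases h0 : specMMPoint ℂ F 0 ≤ 1 - η
      · exact roof_of_offBox hF ht1.le hR (hhigh.trans_le hη'η) (Or.inl h0)
      by_cases h2 : specMMPoint ℂ F 2 ≤ 1 - η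
      · exact roof_of_offBox hF ht1.le hR (hhigh.trans_le hη'η) (Or.inr h2)
      push Not at h0 h2
      exact hbox t htt₀ ht1 F hF (hhigh.trans_le hη'η) h0 h2

/-- ★★ **`PolySaturation` is a corner germ condition too**: `PolySaturation ⟺ ∃ η > 0 ∃ C k ∀ t ∈ [0,1):` the
polynomial roof `t·θ₁ ≤ (1−θ₀) + C(1−t)^{−k}(1−θ₂)` holds at every universal spectral point in the corner box
`{θ₁ < η, θ₀ > 1−η, θ₂ > 1−η}` (high points: `highRoof_poly`, exponent `4`, constant `768/η⁴`, from the power rate of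
the far-edge tower). [cite: LottiRomani1983, Prop. 4.1] [cite: CoppersmithWinograd1982, Thm. 1] [cite: Strassen1988, Thm. 3.8] -/
theorem polySaturation_iff_cornerGerm :
    PolySaturation ↔ ∃ η : ℝ, 0 < η ∧ ∃ (C : ℝ) (k : ℕ), ∀ t : ℝ, 0 ≤ t → t < 1 →
      ∀ F : SpectralMap ℂ, IsUniversalSpectralPoint ℂ F →
        specMMPoint ℂ F 1 < η → 1 - η < specMMPoint ℂ F 0 → 1 - η < specMMPoint ℂ F 2 →
          t * specMMPoint ℂ F 1 ≤ (1 - specMMPoint ℂ F 0) + C * ((1 - t)⁻¹) ^ k * (1 - specMMPoint ℂ F 2) := by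
  rw [polySaturation_iff_roof]
  constructor
  · rintro ⟨C, k, h⟩
    exact ⟨1, one_pos, C, k, fun t h0 h1 F hF _ _ _ => h t h0 h1 F hF⟩
  · rintro ⟨η, hη, C, k, hbox⟩
    have hη'0 : 0 < min η 1 := lt_min hη one_pos
    have hη'1 : min η 1 ≤ 1 := min_le_right _ _
    have hη'η : min η 1 ≤ η := min_le_left _ _
    have hP : (0 : ℝ) ≤ 768 / (min η 1) ^ 4 := by positivity
    have h768 : (768 : ℝ) ≤ 768 / (min η 1) ^ 4 := by
      rw [le_div_iff₀ (by positivity)]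
      have : (min η 1) ^ 4 ≤ 1 := pow_le_one₀ hη'0.le hη'1
      nlinarith
    refine ⟨max C 0 + 768 / (min η 1) ^ 4, max k 4, fun t ht0 ht1 F hF => ?_⟩
    have hs : 0 < 1 - t := by linarith
    have hu : 1 ≤ (1 - t)⁻¹ := (one_le_inv₀ hs).2 (by linarith)
    have hu0 : 0 ≤ (1 - t)⁻¹ := zero_le_one.trans hu
    have hukK : ((1 - t)⁻¹) ^ k ≤ ((1 - t)⁻¹) ^ (max k 4) := pow_le_pow_right₀ hu (le_max_left _ _)
    have hu4K : ((1 - t)⁻¹) ^ 4 ≤ ((1 - t)⁻¹) ^ (max k 4) := pow_le_pow_right₀ hu (le_max_right _ _)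
    have hK0 : 0 ≤ ((1 - t)⁻¹) ^ (max k 4) := pow_nonneg hu0 _
    have hbig : 1 ≤ (max C 0 + 768 / (min η 1) ^ 4) * ((1 - t)⁻¹) ^ (max k 4) := by
      have h1 : (1 : ℝ) ≤ max C 0 + 768 / (min η 1) ^ 4 := by linarith [le_max_right C 0]
      calc (1 : ℝ) = 1 * 1 := by ring
        _ ≤ (max C 0 + 768 / (min η 1) ^ 4) * ((1 - t)⁻¹) ^ (max k 4) :=
          mul_le_mul h1 (one_le_pow₀ hu) zero_le_one (by linarith)
    have hmonoC : C * ((1 - t)⁻¹) ^ k ≤ (max C 0 + 768 / (min η 1) ^ 4) * ((1 - t)⁻¹) ^ (max k 4) := by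
      have h1 : C * ((1 - t)⁻¹) ^ k ≤ max C 0 * ((1 - t)⁻¹) ^ k :=
        mul_le_mul_of_nonneg_right (le_max_left _ _) (pow_nonneg hu0 _)
      have h2 : max C 0 * ((1 - t)⁻¹) ^ k ≤ max C 0 * ((1 - t)⁻¹) ^ (max k 4) :=
        mul_le_mul_of_nonneg_left hukK (le_max_right _ _)
      nlinarith [mul_nonneg hP hK0]
    have hmonoP : 768 / ((min η 1) ^ 4 * (1 - t) ^ 4) ≤
        (max C 0 + 768 / (min η 1) ^ 4) * ((1 - t)⁻¹) ^ (max k 4) := by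
      have e : 768 / ((min η 1) ^ 4 * (1 - t) ^ 4) = 768 / (min η 1) ^ 4 * ((1 - t)⁻¹) ^ 4 := by
        rw [inv_pow, div_mul_eq_div_div, div_eq_mul_inv]
      rw [e]
      have h2 : 768 / (min η 1) ^ 4 * ((1 - t)⁻¹) ^ 4 ≤ 768 / (min η 1) ^ 4 * ((1 - t)⁻¹) ^ (max k 4) :=
        mul_le_mul_of_nonneg_left hu4K hP
      nlinarith [mul_nonneg (le_max_right C 0) hK0]
    by_cases hhigh : min η 1 ≤ specMMPoint ℂ F 1
    · have hroof := highRoof_poly hη'0 hη'1 hs (by linarith) hF hhigh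
      rw [sub_sub_cancel] at hroof
      exact roof_mono hF le_rfl hmonoP hroof
    · push Not at hhigh
      by_cases h0 : specMMPoint ℂ F 0 ≤ 1 - η
      · exact roof_of_offBox hF ht1.le hbig (hhigh.trans_le hη'η) (Or.inl h0)
      by_cases h2 : specMMPoint ℂ F 2 ≤ 1 - η
      · exact roof_of_offBox hF ht1.le hbig (hhigh.trans_le hη'η) (Or.inr h2)
      push Not at h0 h2
      exact roof_mono hF le_rfl hmonoC (hbox t ht0 ht1 F hF (hhigh.trans_le hη'η) h0 h2)

/-! ## §4 A dark-free corner box gives the whole length side of the cut -/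

/-- ★ **DARK-FREE CORNER ⟹ `PolySaturation`**: if some corner box `{θ₁ < η, θ₀ > 1−η, θ₂ > 1−η}` at `ζ⁽¹⁾`
contains no dark spectral point (`θ₀+θ₁+θ₂ ≤ 2` there), then `PolySaturation` holds — with `C = 1, k = 0` on the
box: a light point satisfies `t·θ₁ ≤ θ₁ ≤ ε₀ + ε₂`.  («The spectrum is light NEAR `ζ⁽¹⁾`» is a local form of
`ω = 2`.) [cite: Strassen1988, Thm. 3.8] [cite: AlmanLi2026, Proposition 4.2] -/
theorem polySaturation_of_darkFreeCorner
    (h : ∃ η : ℝ, 0 < η ∧ ∀ F : SpectralMap ℂ, IsUniversalSpectralPoint ℂ F →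
      specMMPoint ℂ F 1 < η → 1 - η < specMMPoint ℂ F 0 → 1 - η < specMMPoint ℂ F 2 →
        specMMPoint ℂ F 0 + specMMPoint ℂ F 1 + specMMPoint ℂ F 2 ≤ 2) :
    PolySaturation := by
  obtain ⟨η, hη, hlight⟩ := h
  refine polySaturation_iff_cornerGerm.2 ⟨η, hη, 1, 0, fun t ht0 ht1 F hF h1 h0 h2 => ?_⟩
  have hsum := hlight F hF h1 h0 h2
  have hθ1 := (AlmanLi2026.prop42_mem_Icc hF 1).1
  have htθ : t * specMMPoint ℂ F 1 ≤ specMMPoint ℂ F 1 := by nlinarith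
  simp only [pow_zero, mul_one, one_mul]
  linarith

/-- ★ **DARK-FREE CORNER ⟹ `SubexpSaturation`** (the deciding crux h₁), with the same box for every rate `c` and
`t₀ = 0`. [cite: Strassen1988, Thm. 3.8] [cite: AlmanLi2026, Proposition 4.2] -/
theorem subexpSaturation_of_darkFreeCorner
    (h : ∃ η : ℝ, 0 < η ∧ ∀ F : SpectralMap ℂ, IsUniversalSpectralPoint ℂ F →
      specMMPoint ℂ F 1 < η → 1 - η < specMMPoint ℂ F 0 → 1 - η < specMMPoint ℂ F 2 →
        specMMPoint ℂ F 0 + specMMPoint ℂ F 1 + specMMPoint ℂ F 2 ≤ 2) :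
    SubexpSaturation := by
  obtain ⟨η, hη, hlight⟩ := h
  refine subexpSaturation_iff_cornerGerm.2 fun c hc => ⟨η, hη, 0, one_pos, fun t ht0 ht1 F hF h1 h0 h2 => ?_⟩
  have hsum := hlight F hF h1 h0 h2
  have hθ1 := (AlmanLi2026.prop42_mem_Icc hF 1).1
  have hε2 : 0 ≤ 1 - specMMPoint ℂ F 2 := sub_nonneg.2 (AlmanLi2026.prop42_mem_Icc hF 2).2
  have htθ : t * specMMPoint ℂ F 1 ≤ specMMPoint ℂ F 1 := by nlinarith
  have hR : 1 ≤ Real.exp (c / (1 - t)) := Real.one_le_exp (div_nonneg hc.le (by linarith))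
  have hRε : (1 - specMMPoint ℂ F 2) ≤ Real.exp (c / (1 - t)) * (1 - specMMPoint ℂ F 2) := by nlinarith
  linarith

/-- **DARK-FREE CORNER ⟹ `h₁ ∧ h₂`** (the two length items of the cut; `SubexpToPoly` holds because its conclusion,
`PolySaturation`, does). [cite: Strassen1988, Thm. 3.8] -/
theorem lengthSide_of_darkFreeCorner
    (h : ∃ η : ℝ, 0 < η ∧ ∀ F : SpectralMap ℂ, IsUniversalSpectralPoint ℂ F →
      specMMPoint ℂ F 1 < η → 1 - η < specMMPoint ℂ F 0 → 1 - η < specMMPoint ℂ F 2 →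
        specMMPoint ℂ F 0 + specMMPoint ℂ F 1 + specMMPoint ℂ F 2 ≤ 2) :
    SubexpSaturation ∧ SubexpToPoly :=
  ⟨subexpSaturation_of_darkFreeCorner h, fun _ => polySaturation_of_darkFreeCorner h⟩

/-! ## §5 What the lineage's certified rates prove at the corner -/

/-- **The corner roof at every rate above the class ceiling is a THEOREM**: for every
`c > c₂ = (5·log(5/4) + 3·log 2)/3 = 1.0650…` there is `t₀ < 1` with `t·θ₁ ≤ (1−θ₀) + e^{c/(1−t)}·(1−θ₂)` for all
`t ∈ [t₀,1)` and EVERY universal spectral point over `ℂ` (the lineage's `clause_above_classCeiling`, read on the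
spectrum).  The crux `SubexpSaturation` is exactly the same statement for the rates `c ∈ (0, c₂]`
(`subexpSaturation_iff_clause_le_classCeiling`). [cite: CoppersmithWinograd1990, §8] [cite: Strassen1988, Thm. 3.8] -/
theorem cornerRoof_above_classCeiling (c : ℝ) (hc : (5 * Real.log (5 / 4) + 3 * Real.log 2) / 3 < c) :
    ∃ t₀ : ℝ, t₀ < 1 ∧ ∀ t : ℝ, t₀ ≤ t → t < 1 → ∀ F : SpectralMap ℂ, IsUniversalSpectralPoint ℂ F →
      t * specMMPoint ℂ F 1 ≤ (1 - specMMPoint ℂ F 0) + Real.exp (c / (1 - t)) * (1 - specMMPoint ℂ F 2) :=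
  (clause_iff_roofClause (le_of_lt (lt_trans classCeiling_pos hc))).1 (clause_above_classCeiling c hc)

/-- **Corner dichotomy of the crux, assembled**: the corner germ law holds at every rate `c > c₂` (proved), and
`SubexpSaturation` is equivalent to the corner germ law at every rate `c ∈ (0, c₂]`.
[cite: CoppersmithWinograd1990, §8] [cite: Strassen1988, Thm. 3.8] -/
theorem subexpSaturation_iff_cornerGerm_le_classCeiling :
    SubexpSaturation ↔ ∀ c : ℝ, 0 < c → c ≤ (5 * Real.log (5 / 4) + 3 * Real.log 2) / 3 →
      ∃ η : ℝ, 0 < η ∧ ∃ t₀ : ℝ, t₀ < 1 ∧ ∀ t : ℝ, t₀ ≤ t → t < 1 →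
        ∀ F : SpectralMap ℂ, IsUniversalSpectralPoint ℂ F →
          specMMPoint ℂ F 1 < η → 1 - η < specMMPoint ℂ F 0 → 1 - η < specMMPoint ℂ F 2 →
            t * specMMPoint ℂ F 1 ≤ (1 - specMMPoint ℂ F 0) + Real.exp (c / (1 - t)) * (1 - specMMPoint ℂ F 2) := by
  rw [subexpSaturation_iff_cornerGerm]
  refine ⟨fun h c hc _ => h c hc, fun h c hc => ?_⟩
  by_cases hle : c ≤ (5 * Real.log (5 / 4) + 3 * Real.log 2) / 3
  · exact h c hc hle
  · push Not at hle
    obtain ⟨t₀, ht₀, ht⟩ := cornerRoof_above_classCeiling c hle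
    exact ⟨1, one_pos, t₀, ht₀, fun t h1 h2 F hF _ _ _ => ht t h1 h2 F hF⟩

end Summit.MatrixMultiplication.MatrixMultiplication.Theorems.SaturationLadderCornerGerm

end
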